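/-
Copyright (c) 2026 the pub-hodgecm-mathlib formalisation cell (harness21).  Prover seat hodgecm-mathlib-K2E3-p23 (g7), HCML Track B «K2-LIT»,
h413 = `stmt-HodgeConjecture-24833`, line `K2_E3_EllipticInputs`, unit U12 «Characters», PART «SC» (ED. 2) leaf (SC-an)₂ `sig_K2E3SupercuspidalTruncatedCharAnalyticTwo`,
road «FC₂» — THE CLOSING FILE: (SC-an)₂ WITH NO LETTER LEFT (L4 «CLOSE-OUT DAY» wave 2026-09-04T14:35–15:40Z).  2026-09-04.
-/
import Summits.HodgeConjecture.HodgeConjecture.Theorems.K2E3SupercuspidalTruncatedCharAnalyticTwoOfLim          -- ★ p861413 (this seat): `sigSCanTwo_of_lim (hLIM) : ‹(SC-an)₂›` — every other FC₂ ∕ (M5h)₂ letter discharged by name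
import Summits.HodgeConjecture.HodgeConjecture.Theorems.K2E3SupercuspidalTruncatedCharLimCancLetterFreeTwo  -- ★ p861357 (K2E3-p31 g0) DOCK A: `explicit_limit_localisation_and_hball_reduction L H …` LETTER-FREE (over ★ p861228 ∕ p861214 ∕ p861187 ∕ p861205 ∕ Thm20Radius₂Coeff)
import HarnessLib

/-!
# h413 ∕ Track B «K2-LIT», unit U12, PART «SC» leaf (SC-an)₂ — **HARISH-CHANDRA'S TWO ESTIMATES ON THE TRUNCATED ORBITAL INTEGRALS OF A SUPERCUSPIDAL COEFFICIENT OF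
# `U(Φ₂)(L⁺_v)`, `v` NON-SPLIT — NO HYPOTHESIS, NO LETTER** (the socket `sig_K2E3SupercuspidalTruncatedCharAnalyticTwo` of PART «SC» ED. 2 :98, TOKEN FOR TOKEN)
# (Harish-Chandra 1970, Part VII §3 Theorem 16 and its proof pp. 70–73; Theorems 14, 15, 18–20 — for `U(1,1)`, by the in-house road «FC₂» of the L4 wave)

Cell `pub/hodgecm-mathlib`, crux H413 = `stmt-HodgeConjecture-24833`, route of record `HCCMUnconditional`; chair K2-lead (g2), L4 LINE-LEAD ∕ dealer K2E3-plan (g4), architect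
K2E3-p25 (g3), (M5h)₂ desks K2E3-p27 (g0) ∕ K2E3-p31 (g0) (dockmaster) ∕ K2E3-p33 (g0) (map).  THEOREMS ONLY (no `def`, no `instance`, no `notation`, no named-fact hypothesis, no
`sorry`); lane `--supports stmt-HodgeConjecture-24833 --as helper`, count-neutral.

THE PROOF = ★ p861413 `K2E3SupercuspidalTruncatedCharAnalyticTwoOfLim.sigSCanTwo_of_lim` (this seat: ★ §B `sigSCanTwo_of_letters` with (F1₂-COVER∕UPPER), (F2₂) ← ★ p861071 K2E3-p26;
(FC-6₂) ← ★ p861203 K2E3-p26; (FC-5c₂) ← ★ p861142 K2E3-p28; (M5h)₂ ← ★ p861288 this seat ∘ (SHELL₂) ★ p861358 ∕ (TORΩ₂)(DEPTH₂) ★ p861268 K2E3-p33 ∕ (TOK₂) ★ p861307 K2E3-p29) applied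
to its LAST letter (LIM₂) := ★ p861357 `K2E3SupercuspidalTruncatedCharLimCancLetterFreeTwo.explicit_limit_localisation_and_hball_reduction L Φ₂` (K2E3-p31 (g0) DOCK A over ★ p861228
[M6′]₂ B ∕ ★ p861214 [M6′]₂ A (K2E3-p36) ∕ ★ p861187 Cartan₂ ∕ ★ p861205 (D2)₂ (K2E3-p34) ∕ Thm20Radius₂ (K2E3-p14) ∕ ★ [M4]₂ p861272+p861335 ∕ ★ [M3]₂ U2 cusp cancellation (K2E3-p32) ∕
★ [M1]₂ (K2E3-p37) ∕ ★ (ε)₂ HCD₂-rpow (K2E3-p29, K2E3-p27) ∕ ★ HeightBall₂ (K2E3-p30, K2E3-p33) ∕ ★ (FC-9)₂ + FinConj₂ (this seat) …) — the whole `Fin 2` port of the ★ N = 3 (SC-an)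
engine, assembled by name; `Φ₂ = Matrix.of (i + j + 1 = 2)`.
* **`sigSCanTwo : ‹sig_K2E3SupercuspidalTruncatedCharAnalyticTwo's statement VERBATIM›`** — THE TIE for PART «SC» ED. 3 is the ONE LINE
  `theorem sig_K2E3SupercuspidalTruncatedCharAnalyticTwo := K2E3SupercuspidalTruncatedCharAnalyticTwoClosed.sigSCanTwo` (+ this import); (SC-an)₂ then ★ END-TO-END, (qs2-sc) ★ by import.

HONEST LABEL.  HC_CM is proved only modulo the 7 printed citations (2 remaining named inputs: hLiu418 = `stmt-HodgeConjecture-24832`, h413 = `stmt-HodgeConjecture-24833`)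
until rung 0 closes; count-neutral helper: (SC-an)₂ ∕ (qs2-sc) become ★ only when the dealer re-ties PART «SC» :98 to this head and the gate BUILDS it; the other U12 sockets
((ps-rep), (res-ω), (11-3ns-res), (11-ge4), «LIE», …) are untouched.

## References
* [HarishChandra1970] Harish-Chandra (notes by G. van Dijk), *Harmonic Analysis on Reductive p-adic Groups*, LNM 162 (1970), Part VII §3 Thm. 16 p. 67, pp. 70–73; Thms 14–15, 18–20.
* [HarishChandra1999] Harish-Chandra (notes by S. DeBacker, P. J. Sally Jr.), *Admissible Invariant Distributions on Reductive p-adic Groups*, AMS ULS 16 (1999), Thm. 16.1 p. 77.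
* [Rogawski1990] J. D. Rogawski, *Automorphic Representations of Unitary Groups in Three Variables*, Ann. of Math. Stud. 123 (1990), §1.9–§1.10 pp. 8–9, §12.2 p. 173.
-/

set_option autoImplicit false
-- the mandated namespace repeats the single-problem summit's segment (`HodgeConjecture.HodgeConjecture`)
set_option linter.dupNamespace false

noncomputable section

open MeasureTheory Measure Set Filter Topology NumberField IsDedekindDomain
open scoped NNReal ENNReal Pointwise Matrix MatrixGroups WithZero Valued
open ValuativeRel
open Literature.NumberTheory.Automorphic Literature.NumberTheory.Automorphic.UnitaryGroup Literature.NumberTheory.Automorphic.HermitianLattice Literature.NumberTheory.Rogawski1990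
open Literature.NumberTheory.GaloisRepresentations Literature.NumberTheory.GaloisRepresentations.IsNonarchimedeanLocalField

namespace Summit.HodgeConjecture.HodgeConjecture.Cruxes.H413.K2E3SupercuspidalTruncatedCharAnalyticTwoClosed

set_option maxHeartbeats 1600000 in -- long statement (the (SC-an)₂ socket text) and the by-name assembly
set_option synthInstance.maxHeartbeats 400000 in
open scoped Classical in
/-- **(SC-an)₂ — NO HYPOTHESIS.**  For every CM field `L`, every finite place `v` of `L⁺` with all `w ∣ v` fixed by complex conjugation (non-split), every Haar measure `μ` on
`U(Φ₂)(L⁺_v) = (cmDatum L 2 Φ₂).Local v`, every supercuspidal `SmoothIrrep r` with an invariant positive-definite Hermitian form `B` and every `v₁ ≠ 0`: there are a compact exhaustion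
`Ω`, a limit `F` and a majorant `M ∈ L¹_loc(μ)` with (SC-lim∖ell) `∫_{Ω n} B v₁ (r(xgx⁻¹) v₁) → F g` for a.e. `g` not regular-with-compact-centraliser and (SC-dom) `‖∫_{Ω n} …‖ ≤ M g` a.e.,
every `n` — PART «SC» ED. 2 :98 `sig_K2E3SupercuspidalTruncatedCharAnalyticTwo` TOKEN FOR TOKEN.  Proof: ★ `sigSCanTwo_of_lim` at (LIM₂) := ★ p861357 at `H := Φ₂`.
[cite: HarishChandra1970, Part VII §3 Thm. 16 p. 67, pp. 70–73; Thms 14–15, 18–20] [cite: HarishChandra1999, Thm. 16.1 p. 77] [cite: Rogawski1990, §12.2 p. 173] -/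
theorem sigSCanTwo :
    ∀ (L : Type) [Field L] [NumberField L] [IsCMField L] (v : HeightOneSpectrum (𝓞 ↥(maximalRealSubfield L))),
      (∀ w : PlacesOver L v, IsCMField.complexConj L • w.1 = w.1) →
    ∀ [MeasurableSpace ((UnitaryGroup.cmDatum L 2 (Matrix.of fun i j : Fin 2 => if i.val + j.val + 1 = 2 then (1 : L) else 0)).Local v)] [BorelSpace ((UnitaryGroup.cmDatum L 2 (Matrix.of fun i j : Fin 2 => if i.val + j.val + 1 = 2 then (1 : L) else 0)).Local v)]
      (μ : Measure ((UnitaryGroup.cmDatum L 2 (Matrix.of fun i j : Fin 2 => if i.val + j.val + 1 = 2 then (1 : L) else 0)).Local v)) [μ.IsHaarMeasure]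
      (r : SmoothIrrep ((UnitaryGroup.cmDatum L 2 (Matrix.of fun i j : Fin 2 => if i.val + j.val + 1 = 2 then (1 : L) else 0)).Local v)), r.ρ.IsSupercuspidal →
    ∀ (B : r.V →ₗ⋆[ℂ] r.V →ₗ[ℂ] ℂ), B.IsSymm → (∀ x : r.V, x ≠ 0 → 0 < (B x x).re) →
      (∀ (g : (UnitaryGroup.cmDatum L 2 (Matrix.of fun i j : Fin 2 => if i.val + j.val + 1 = 2 then (1 : L) else 0)).Local v) (x y : r.V), B (r.ρ g x) (r.ρ g y) = B x y) →
    ∀ (v₁ : r.V), v₁ ≠ 0 →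
      ∃ (Ω : CompactExhaustion ((UnitaryGroup.cmDatum L 2 (Matrix.of fun i j : Fin 2 => if i.val + j.val + 1 = 2 then (1 : L) else 0)).Local v))
        (F : (UnitaryGroup.cmDatum L 2 (Matrix.of fun i j : Fin 2 => if i.val + j.val + 1 = 2 then (1 : L) else 0)).Local v → ℂ) (M : (UnitaryGroup.cmDatum L 2 (Matrix.of fun i j : Fin 2 => if i.val + j.val + 1 = 2 then (1 : L) else 0)).Local v → ℝ),
        (∀ᵐ g ∂μ, ¬ (IsRegularElt (g.val : GL (Fin 2) (UnitaryGroup.LocalRing L v)) ∧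
            IsCompact ((Subgroup.centralizer ({g} : Set ((UnitaryGroup.cmDatum L 2 (Matrix.of fun i j : Fin 2 => if i.val + j.val + 1 = 2 then (1 : L) else 0)).Local v))) : Set ((UnitaryGroup.cmDatum L 2 (Matrix.of fun i j : Fin 2 => if i.val + j.val + 1 = 2 then (1 : L) else 0)).Local v))) →
          Tendsto (fun n => ∫ x in Ω n, B v₁ (r.ρ (x * g * x⁻¹) v₁) ∂μ) atTop (𝓝 (F g))) ∧
        (∀ n : ℕ, ∀ᵐ g ∂μ, ‖∫ x in Ω n, B v₁ (r.ρ (x * g * x⁻¹) v₁) ∂μ‖ ≤ M g) ∧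
        LocallyIntegrable M μ :=
  K2E3SupercuspidalTruncatedCharAnalyticTwoOfLim.sigSCanTwo_of_lim fun L _ _ _ =>
    K2E3SupercuspidalTruncatedCharLimCancLetterFreeTwo.explicit_limit_localisation_and_hball_reduction L
      (Matrix.of fun i j : Fin 2 => if i.val + j.val + 1 = 2 then (1 : L) else 0)

end Summit.HodgeConjecture.HodgeConjecture.Cruxes.H413.K2E3SupercuspidalTruncatedCharAnalyticTwoClosed

end
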